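import Mathlib
import Summits.NavierStokesRegularity.NavierStokesRegularity.Theorems.TaoLadderRungTwoBreakBlowupRigidityOneEnergyClimbing
import Summits.NavierStokesRegularity.NavierStokesRegularity.Theorems.TaoLadderRungTwoBreakBlowupRigidityOneTypeIIDichotomy
import Summits.NavierStokesRegularity.NavierStokesRegularity.Theorems.TaoLadderRungTwoBreakBlowupRigidityOneRenormalisedFlow
import HarnessLib

/-!
# EVERY SHELL FIRES AT THE CRITICAL SCALING: along the maximal exact flow of a robust blow-up EVERY shell `k` reaches
  the floor `C_A · T⋆ · Λ^{k+1} · ‖x_k(t)‖ > 1` at some `t < T⋆` (late for high shells), and the self-similar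
  renormalisation is (S₅)-SURVIVING FORWARD — support for `stub_eternalFromBlowup` of K2(1)
  `TaoLadderRungTwoBreak.BlowupRigidityOne` (stmt-NavierStokesRegularity-20206)

MODEL lattice ODEs only (Tao 2016 §4 (4.3), Lemma 4.1 (4.5)–(4.10), (4.12), §6.4); nothing here is a statement about the
Navier–Stokes equations; NO item is closed (`--supports stmt-NavierStokesRegularity-20206`). General `m`; DEF-FREE.

MECHANISM (a quiet shell blocks the cascade). By «no spontaneous emission» (`norm_succ_le_action_sq`,
`‖x_{j+1}(t)‖ ≤ C_A Λ^j ∫₀ᵗ‖x_j‖²`) the normalised amplitudes `u_j := C_A T Λ^{j+1} sup_{[0,T)}‖x_j‖` of an exact flow from a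
one-shell datum obey the DOUBLING RECURSION `u_{j+1} ≤ u_j²`; one shell with `u_k ≤ 1` keeps all higher shells at `≤ 1`
(`quietShell_propagates`), the critical amplitude stays bounded, and the flow cannot blow up. Contrapositive:
* `everyShellFires` — unbounded critical amplitude on `[0,T)` ⇒ on EVERY shell `k ∈ ℕ` some `t_k ∈ [0,T)` has
  `1 < C_A T Λ^{k+1}‖x_k(t_k)‖`: a UNIFORM-IN-`k` floor at the critical scaling, shell by shell (the tree had unbounded
  critical amplitude on SOME shells `k → ∞`, `highShellBlowup_of_noGlobalCascade`);
* `firing_late` — for `T' < T`, shells `k ≥ K(T')` do not reach the floor before `T'` ((4.5)-regularity);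
* `everyShellFires_of_noGlobalCascade` — the package along the maximal exact flow of every robust blow-up;
* `eternalSurvivingFwd_five_of_noGlobalCascade` — the renormalisation `W_n(σ) = Λ^n e^{-σ} x_n(T⋆ - e^{-σ})` of that flow
  is FORWARD (S₅)-SURVIVING, `EternalSurvivingFwd 5 ε₀ W` (`physWeight 5 = 1`, `e^{2σ}‖W_n(σ)‖² = (Λ^n‖x_n(t)‖)² ≥ (C_A T⋆ Λ)⁻²`
  at the firing log-times `σ_k → ∞`).

HONEST LABEL. The stub asks for an admissible eternal ω-limit that is (S₁)-surviving (`(1+ε₀)^n‖x_n‖² ≥ c`); this file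
gives survival of the renormalised flow itself at the CRITICAL exponent `a = 5` (`(1+ε₀)^{5n}‖x_n‖² ≥ c`), unconditionally.
The gap `a = 5 → a = 1` (four powers of `1+ε₀` per shell = the NS dissipation scaling) is the open front-survival (F2b)
content of the item; the admissibility clauses of `IsEternal` and `stub_eternalIsDSS` are untouched. No stub, crux or
summit is proved; rung 0.
-/

noncomputable section

-- the summit and its single sub-problem share the name (CONVENTIONS §1)
set_option linter.dupNamespace false

open Set Filter Topology MeasureTheory intervalIntegral

namespace Summit.NavierStokesRegularity.NavierStokesRegularity.Theorems

namespace BlowupRigidityOne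

open Literature.Analysis.FluidPDE Literature.Analysis.FluidPDE.TaoCascade

variable {m : ℕ}

/-! ### A quiet shell stays quiet above: the doubling recursion -/

/-- **A QUIET SHELL PROPAGATES UPWARD.** For a cancelling table and an exact flow on `[0,T)` (`T > 0`) from the
one-shell datum `X₀` at shell `0` ((4.5)-regular before `T`): if shell `k` obeys `C_A T Λ^{k+1}‖x_k(t)‖ ≤ η` on `[0,T)`
with `0 ≤ η ≤ 1`, then shell `k+j` obeys `C_A T Λ^{k+j+1}‖x_{k+j}(t)‖ ≤ η^{j+1}` on `[0,T)` for every `j` (the doubling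
recursion `u_{j+1} ≤ u_j²` from `‖x_{j+1}(t)‖ ≤ C_A Λ^j ∫₀ᵗ‖x_j‖²`, weakened to a geometric rate).
[cite: Tao2016AveragedNS, §4 (4.3), Lemma 4.1 (4.8)–(4.10); §1.2 (energy is fed shell after shell)] -/
theorem quietShell_propagates {ε₀ T : ℝ} (hε : 0 < ε₀) (hT : 0 < T)
    {α : Fin m → Fin m → Fin m → ℤ × ℤ × ℤ → ℝ} (hc : IsCancellingCoeff α)
    {X : Fin m → ℤ → ℝ → ℝ} {X₀ : Fin m → ℝ}
    (hder : ∀ i k, ∀ t ∈ Ico 0 T, HasDerivWithinAt (X i k) (quadTerm ε₀ α X i k t) (Ici 0) t)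
    (hinit : ∀ i k, X i k 0 = if k = 0 then X₀ i else 0)
    (hlow : ∀ i k t, k < 0 → X i k t = 0)
    (hreg : ∀ T' : ℝ, T' < T → ∃ M : ℝ, ∀ t ∈ Icc 0 T', ∀ (i : Fin m) (k : ℤ),
      (1 + (1 + ε₀) ^ ((10 : ℝ) * k)) * |X i k t| ≤ M)
    (k : ℕ) {η : ℝ} (hη0 : 0 ≤ η) (hη1 : η ≤ 1)
    (hquiet : ∀ t ∈ Ico 0 T, fluxConst α * T * bigLam ε₀ ^ (k + 1) * ‖shellVec X (k : ℤ) t‖ ≤ η) :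
    ∀ j : ℕ, ∀ t ∈ Ico 0 T,
      fluxConst α * T * bigLam ε₀ ^ (k + j + 1) * ‖shellVec X ((k + j : ℕ) : ℤ) t‖ ≤ η ^ (j + 1) := by
  have hL : 0 < bigLam ε₀ := bigLam_pos (by linarith)
  have hCA : 0 ≤ fluxConst α := fluxConst_nonneg α
  intro j
  induction j with
  | zero => intro t ht; simpa only [Nat.add_zero, zero_add, pow_one] using hquiet t ht
  | succ j ih =>
    intro t ht
    -- continuity of `‖x_{k+j}‖` on `[0,t]`
    have hcx : ContinuousOn (fun s => shellVec X ((k + j : ℕ) : ℤ) s) (Ico 0 T) := by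
      have hcp : ContinuousOn (fun s => fun i => X i ((k + j : ℕ) : ℤ) s) (Ico 0 T) :=
        continuousOn_pi.2 fun i s hs => ((hder i _ s hs).continuousWithinAt).mono fun x hx => hx.1
      exact (PiLp.continuous_toLp 2 (fun _ : Fin m => ℝ)).comp_continuousOn hcp
    have hsub : Icc 0 t ⊆ Ico 0 T := fun s hs => ⟨hs.1, lt_of_le_of_lt hs.2 ht.2⟩
    have hcn : ContinuousOn (fun s => ‖shellVec X ((k + j : ℕ) : ℤ) s‖) (Icc 0 t) := (hcx.mono hsub).norm
    -- no spontaneous emission across the bond `k+j → k+j+1`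
    have h1 := norm_succ_le_action_sq hε hc hder hinit hlow hreg (k + j) t ht
    have hcast : (((k + (j + 1) : ℕ) : ℤ)) = ((k + j : ℕ) : ℤ) + 1 := by push_cast; ring
    set c : ℝ := fluxConst α * T * bigLam ε₀ ^ (k + j + 1) with hc_def
    -- the induction hypothesis under the integral
    have hint : ∫ s in (0:ℝ)..t, (c * ‖shellVec X ((k + j : ℕ) : ℤ) s‖) ^ 2 ≤
        ∫ _s in (0:ℝ)..t, (η ^ (j + 1)) ^ 2 := by
      refine intervalIntegral.integral_mono_on ht.1 ?_ intervalIntegrable_const fun s hs => ?_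
      · exact (((continuousOn_const.mul hcn).pow 2).mono (by rw [uIcc_of_le ht.1])).intervalIntegrable
      · exact pow_le_pow_left₀ (by positivity) (ih s (hsub hs)) 2
    have hint2 : ∫ _s in (0:ℝ)..t, (η ^ (j + 1)) ^ 2 = t * (η ^ (j + 1)) ^ 2 := by
      rw [intervalIntegral.integral_const, smul_eq_mul, sub_zero]
    have hsqint : ∫ s in (0:ℝ)..t, (c * ‖shellVec X ((k + j : ℕ) : ℤ) s‖) ^ 2 =
        c ^ 2 * ∫ s in (0:ℝ)..t, ‖shellVec X ((k + j : ℕ) : ℤ) s‖ ^ 2 := by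
      rw [← intervalIntegral.integral_const_mul]
      exact intervalIntegral.integral_congr fun s _ => by ring
    -- algebra: `C_A T Λ^{k+j+2} · C_A Λ^{k+j} · I = T⁻¹ c² I`
    have halg : fluxConst α * T * bigLam ε₀ ^ (k + (j + 1) + 1) *
        (fluxConst α * bigLam ε₀ ^ (k + j) * ∫ s in (0:ℝ)..t, ‖shellVec X ((k + j : ℕ) : ℤ) s‖ ^ 2) =
        T⁻¹ * (c ^ 2 * ∫ s in (0:ℝ)..t, ‖shellVec X ((k + j : ℕ) : ℤ) s‖ ^ 2) := by
      rw [hc_def]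
      field_simp
      ring
    calc fluxConst α * T * bigLam ε₀ ^ (k + (j + 1) + 1) * ‖shellVec X ((k + (j + 1) : ℕ) : ℤ) t‖
        ≤ fluxConst α * T * bigLam ε₀ ^ (k + (j + 1) + 1) *
            (fluxConst α * bigLam ε₀ ^ (k + j) * ∫ s in (0:ℝ)..t, ‖shellVec X ((k + j : ℕ) : ℤ) s‖ ^ 2) := by
          rw [hcast]
          exact mul_le_mul_of_nonneg_left h1 (by positivity)
      _ = T⁻¹ * ∫ s in (0:ℝ)..t, (c * ‖shellVec X ((k + j : ℕ) : ℤ) s‖) ^ 2 := by rw [halg, hsqint]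
      _ ≤ T⁻¹ * (t * (η ^ (j + 1)) ^ 2) := by
          rw [← hint2]
          exact mul_le_mul_of_nonneg_left hint (inv_nonneg.2 hT.le)
      _ ≤ T⁻¹ * (T * (η ^ (j + 1)) ^ 2) := by
          refine mul_le_mul_of_nonneg_left ?_ (inv_nonneg.2 hT.le)
          exact mul_le_mul_of_nonneg_right ht.2.le (by positivity)
      _ = (η ^ (j + 1)) ^ 2 := by rw [← mul_assoc, inv_mul_cancel₀ hT.ne', one_mul]
      _ ≤ η ^ (j + 1 + 1) := by
          rw [← pow_mul]
          exact pow_le_pow_of_le_one hη0 hη1 (by omega)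

/-! ### Contrapositive: every shell fires -/

/-- **EVERY SHELL FIRES AT THE CRITICAL SCALING.** For a cancelling table and an exact flow on `[0,T)` (`T > 0`) from the
one-shell datum `X₀` at shell `0`, (4.5)-regular before `T`, whose CRITICAL AMPLITUDE `sup_{i,k}(1+ε₀)^{5k/2}|X_{i,k}|` is
UNBOUNDED on `[0,T)` (as along the maximal flow of a robust blow-up, `criticalBlowup_of_noGlobalCascade`): EVERY shell
`k ∈ ℕ` reaches `1 < C_A · T · Λ^{k+1} · ‖x_k(t)‖` at some `t ∈ [0,T)`. (A quiet shell — `≤ 1` throughout — would keep all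
higher shells quiet by `quietShell_propagates`, bounding the critical amplitude by
`(1+ε₀)^{5k/2}√(Σ X₀ᵢ²) + (C_A T Λ)⁻¹`.)
[cite: Tao2016AveragedNS, §4 (4.3), Lemma 4.1 (4.5), (4.8)–(4.10), Thm. 4.2 (statement shape); §1.2] -/
theorem everyShellFires {ε₀ T : ℝ} (hε : 0 < ε₀) (hT : 0 < T)
    {α : Fin m → Fin m → Fin m → ℤ × ℤ × ℤ → ℝ} (hc : IsCancellingCoeff α)
    {X : Fin m → ℤ → ℝ → ℝ} {X₀ : Fin m → ℝ}
    (hder : ∀ i k, ∀ t ∈ Ico 0 T, HasDerivWithinAt (X i k) (quadTerm ε₀ α X i k t) (Ici 0) t)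
    (hinit : ∀ i k, X i k 0 = if k = 0 then X₀ i else 0)
    (hlow : ∀ i k t, k < 0 → X i k t = 0)
    (hreg : ∀ T' : ℝ, T' < T → ∃ M : ℝ, ∀ t ∈ Icc 0 T', ∀ (i : Fin m) (k : ℤ),
      (1 + (1 + ε₀) ^ ((10 : ℝ) * k)) * |X i k t| ≤ M)
    (hcrit : ∀ L : ℝ, ∃ t : ℝ, 0 ≤ t ∧ t < T ∧
      ∃ (i : Fin m) (k : ℤ), L < (1 + ε₀) ^ ((5 : ℝ) * k / 2) * |X i k t|)
    (k : ℕ) : ∃ t : ℝ, 0 ≤ t ∧ t < T ∧ 1 < fluxConst α * T * bigLam ε₀ ^ (k + 1) * ‖shellVec X (k : ℤ) t‖ := by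
  have hb : (0 : ℝ) < 1 + ε₀ := by linarith
  have hb1 : (1 : ℝ) ≤ 1 + ε₀ := by linarith
  have hL : 0 < bigLam ε₀ := bigLam_pos (by linarith)
  have hCA : 0 ≤ fluxConst α := fluxConst_nonneg α
  by_contra hcon
  push Not at hcon -- `hcon : ∀ t, 0 ≤ t → t < T → C_A T Λ^{k+1} ‖x_k(t)‖ ≤ 1`
  have hq := quietShell_propagates hε hT hc hder hinit hlow hreg k (η := 1) zero_le_one le_rfl
    (fun t ht => hcon t ht.1 ht.2)
  -- high shells: `Λ^{k+j+1} ‖x_{k+j+1}(t)‖ ≤ (C_A T Λ)⁻¹` (also when `C_A = 0`: then `x_{k+j+1} ≡ 0`)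
  have hhigh : ∀ j : ℕ, ∀ t ∈ Ico (0:ℝ) T,
      bigLam ε₀ ^ (k + j + 1) * ‖shellVec X ((k + j + 1 : ℕ) : ℤ) t‖ ≤ (fluxConst α * T * bigLam ε₀)⁻¹ := by
    intro j t ht
    rcases hCA.eq_or_lt with h0 | hpos
    · -- `C_A = 0`: no emission at all across any bond
      have h1 := norm_succ_le_action_sq hε hc hder hinit hlow hreg (k + j) t ht
      rw [← h0, zero_mul, zero_mul] at h1
      have hcast : (((k + j + 1 : ℕ) : ℤ)) = ((k + j : ℕ) : ℤ) + 1 := by push_cast; ring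
      rw [hcast, le_antisymm h1 (norm_nonneg _), mul_zero, ← h0, zero_mul, zero_mul, inv_zero]
    · have h2 := hq (j + 1) t ht
      have hcast : ((k + (j + 1) : ℕ) : ℤ) = ((k + j + 1 : ℕ) : ℤ) := by push_cast; ring
      rw [hcast, show k + (j + 1) + 1 = k + j + 1 + 1 by ring, one_pow] at h2
      have hpos' : 0 < fluxConst α * T * bigLam ε₀ := by positivity
      rw [inv_eq_one_div, le_div_iff₀ hpos']
      calc bigLam ε₀ ^ (k + j + 1) * ‖shellVec X ((k + j + 1 : ℕ) : ℤ) t‖ * (fluxConst α * T * bigLam ε₀)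
          = fluxConst α * T * bigLam ε₀ ^ (k + j + 1 + 1) * ‖shellVec X ((k + j + 1 : ℕ) : ℤ) t‖ := by ring
        _ ≤ 1 := h2
  -- the critical amplitude is bounded by `L₀`
  set D : ℝ := Real.sqrt (∑ j, X₀ j ^ 2) with hD_def
  have hD0 : 0 ≤ D := Real.sqrt_nonneg _
  set L₀ : ℝ := (1 + ε₀) ^ ((5 : ℝ) * k / 2) * D + (fluxConst α * T * bigLam ε₀)⁻¹ with hL₀_def
  have hinv0 : 0 ≤ (fluxConst α * T * bigLam ε₀)⁻¹ := inv_nonneg.2 (by positivity)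
  have hpk : 0 ≤ (1 + ε₀) ^ ((5 : ℝ) * k / 2) * D := mul_nonneg (Real.rpow_nonneg hb.le _) hD0
  have hbound : ∀ t ∈ Ico (0:ℝ) T, ∀ (i : Fin m) (n : ℤ),
      (1 + ε₀) ^ ((5 : ℝ) * n / 2) * |X i n t| ≤ L₀ := by
    intro t ht i n
    rcases lt_or_ge n 0 with hn | hn
    · rw [hlow i n t hn, abs_zero, mul_zero]; positivity
    · obtain ⟨n', rfl⟩ := Int.eq_ofNat_of_zero_le hn
      rcases le_or_gt n' k with hnk | hnk
      · -- low shells: amplitude ≤ datum norm, weight ≤ weight of shell `k`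
        have ha := abs_le_datumNorm hε hc hder hinit hlow hreg t ht i (n' : ℤ)
        have hw : (1 + ε₀) ^ ((5 : ℝ) * ((n' : ℤ) : ℝ) / 2) ≤ (1 + ε₀) ^ ((5 : ℝ) * k / 2) := by
          refine Real.rpow_le_rpow_of_exponent_le hb1 ?_
          have : ((n' : ℤ) : ℝ) ≤ (k : ℝ) := by exact_mod_cast hnk
          linarith
        calc (1 + ε₀) ^ ((5 : ℝ) * ((n' : ℤ) : ℝ) / 2) * |X i (n' : ℤ) t|
            ≤ (1 + ε₀) ^ ((5 : ℝ) * k / 2) * D :=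
              mul_le_mul hw ha (abs_nonneg _) (Real.rpow_nonneg hb.le _)
          _ ≤ L₀ := by rw [hL₀_def]; linarith
      · -- high shells: `n' = k + j + 1`
        obtain ⟨j, rfl⟩ : ∃ j : ℕ, n' = k + j + 1 := ⟨n' - k - 1, by omega⟩
        have hcomp : |X i ((k + j + 1 : ℕ) : ℤ) t| ≤ ‖shellVec X ((k + j + 1 : ℕ) : ℤ) t‖ := by
          simpa [shellVec_apply, Real.norm_eq_abs] using PiLp.norm_apply_le (shellVec X ((k + j + 1 : ℕ) : ℤ) t) i
        have hw : (1 + ε₀) ^ ((5 : ℝ) * (((k + j + 1 : ℕ) : ℤ) : ℝ) / 2) = bigLam ε₀ ^ (k + j + 1) := by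
          rw [DSSOneShift.bigLam_zpow_eq_rpow hb ((k + j + 1 : ℕ) : ℤ), zpow_natCast]
        calc (1 + ε₀) ^ ((5 : ℝ) * (((k + j + 1 : ℕ) : ℤ) : ℝ) / 2) * |X i ((k + j + 1 : ℕ) : ℤ) t|
            ≤ bigLam ε₀ ^ (k + j + 1) * ‖shellVec X ((k + j + 1 : ℕ) : ℤ) t‖ := by
              rw [hw]; exact mul_le_mul_of_nonneg_left hcomp (pow_nonneg hL.le _)
          _ ≤ (fluxConst α * T * bigLam ε₀)⁻¹ := hhigh j t ht
          _ ≤ L₀ := by rw [hL₀_def]; linarith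
  obtain ⟨t, ht0, htT, i, n, hlt⟩ := hcrit L₀
  exact absurd (hbound t ⟨ht0, htT⟩ i n) (not_le.2 hlt)

/-- **HIGH SHELLS FIRE LATE.** Under (4.5)-regularity before `T`, for every `T' < T` there is `K` such that no shell
`k ≥ K` carries the critical floor before `T'`: `C_A T Λ^{k+1}‖x_k(t)‖ ≤ 1` for all `t ∈ [0,T']` (the (4.5) weight
`(1+ε₀)^{10k} = Λ^{4k}` beats the critical weight `Λ^{k+1}` by `Λ^{3k}`).
[cite: Tao2016AveragedNS, §4 Lemma 4.1 (4.5) and (4.1)] -/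
theorem firing_late {ε₀ T : ℝ} (hε : 0 < ε₀) (hT : 0 < T)
    {α : Fin m → Fin m → Fin m → ℤ × ℤ × ℤ → ℝ} {X : Fin m → ℤ → ℝ → ℝ}
    (hreg : ∀ T' : ℝ, T' < T → ∃ M : ℝ, ∀ t ∈ Icc 0 T', ∀ (i : Fin m) (k : ℤ),
      (1 + (1 + ε₀) ^ ((10 : ℝ) * k)) * |X i k t| ≤ M)
    {T' : ℝ} (hT' : T' < T) :
    ∃ K : ℕ, ∀ k : ℕ, K ≤ k → ∀ t ∈ Icc 0 T',
      fluxConst α * T * bigLam ε₀ ^ (k + 1) * ‖shellVec X (k : ℤ) t‖ ≤ 1 := by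
  have hb : (0 : ℝ) < 1 + ε₀ := by linarith
  have hL : 0 < bigLam ε₀ := bigLam_pos (by linarith)
  have hL1 : 1 < bigLam ε₀ := Real.one_lt_rpow (by linarith) (by norm_num)
  have hCA : 0 ≤ fluxConst α := fluxConst_nonneg α
  obtain ⟨M, hM⟩ := hreg T' hT'
  -- the (4.5) weight dominates `Λ^{4k}`: componentwise `Λ^{4k} |X_{i,k}(t)| ≤ M` on `[0,T']`
  have hcomp : ∀ (k : ℕ), ∀ t ∈ Icc (0:ℝ) T', ∀ i : Fin m, (bigLam ε₀ ^ k) ^ 4 * |X i (k : ℤ) t| ≤ M := by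
    intro k t ht i
    have h := hM t ht i (k : ℤ)
    have hw : (bigLam ε₀ ^ k) ^ 4 ≤ 1 + (1 + ε₀) ^ ((10 : ℝ) * ((k : ℤ) : ℝ)) := by
      have h4 : (bigLam ε₀ ^ k) ^ 4 = (1 + ε₀) ^ (10 * k) := by
        rw [show ((bigLam ε₀ ^ k) ^ 4) = ((bigLam ε₀ ^ k) ^ 2) ^ 2 by ring, bigLam_pow_sq hε.le k, ← pow_mul]
        ring_nf
      have h10 : (1 + ε₀) ^ ((10 : ℝ) * ((k : ℤ) : ℝ)) = (1 + ε₀) ^ (10 * k) := by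
        rw [show (10 : ℝ) * ((k : ℤ) : ℝ) = ((10 * k : ℕ) : ℝ) by push_cast; ring, Real.rpow_natCast]
      rw [h4, h10]
      linarith [pow_nonneg hb.le (10 * k)]
    calc (bigLam ε₀ ^ k) ^ 4 * |X i (k : ℤ) t| ≤ (1 + (1 + ε₀) ^ ((10 : ℝ) * ((k : ℤ) : ℝ))) * |X i (k : ℤ) t| :=
          mul_le_mul_of_nonneg_right hw (abs_nonneg _)
      _ ≤ M := h
  -- choose `K` with `(C_A T Λ √m |M| + 1) · (Λ³)⁻¹^K ≤ 1`
  set c : ℝ := fluxConst α * T * bigLam ε₀ * Real.sqrt m * |M| + 1 with hc_def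
  have hc0 : 0 < c := by positivity
  have hy1 : ((bigLam ε₀) ^ 3)⁻¹ < 1 := inv_lt_one_of_one_lt₀ (one_lt_pow₀ hL1 (by norm_num))
  have hy0 : 0 ≤ ((bigLam ε₀) ^ 3)⁻¹ := by positivity
  obtain ⟨K, hK⟩ := exists_pow_lt_of_lt_one (inv_pos.2 hc0) hy1
  refine ⟨K, fun k hk t ht => ?_⟩
  -- `‖x_k(t)‖ ≤ √m |M| / Λ^{4k}`
  have hMk : ∀ i : Fin m, |X i (k : ℤ) t| ≤ |M| * ((bigLam ε₀ ^ k) ^ 4)⁻¹ := by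
    intro i
    have h := hcomp k t ht i
    have hpos : 0 < (bigLam ε₀ ^ k) ^ 4 := by positivity
    rw [← div_eq_mul_inv, le_div_iff₀ hpos, mul_comm]
    exact h.trans (le_abs_self M)
  have hnorm := norm_shellVec_le_sqrt_mul (by positivity) hMk
  have hyk : (((bigLam ε₀) ^ 3)⁻¹) ^ k ≤ (((bigLam ε₀) ^ 3)⁻¹) ^ K := pow_le_pow_of_le_one hy0 hy1.le hk
  have hck : c * (((bigLam ε₀) ^ 3)⁻¹) ^ k ≤ 1 := by
    calc c * (((bigLam ε₀) ^ 3)⁻¹) ^ k ≤ c * (((bigLam ε₀) ^ 3)⁻¹) ^ K := mul_le_mul_of_nonneg_left hyk hc0.le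
      _ ≤ c * c⁻¹ := mul_le_mul_of_nonneg_left hK.le hc0.le
      _ = 1 := mul_inv_cancel₀ hc0.ne'
  have hq3 : (((bigLam ε₀) ^ 3)⁻¹) ^ k = ((bigLam ε₀ ^ k) ^ 3)⁻¹ := by
    rw [inv_pow, ← pow_mul, mul_comm, pow_mul]
  calc fluxConst α * T * bigLam ε₀ ^ (k + 1) * ‖shellVec X (k : ℤ) t‖
      ≤ fluxConst α * T * bigLam ε₀ ^ (k + 1) * (Real.sqrt m * (|M| * ((bigLam ε₀ ^ k) ^ 4)⁻¹)) :=
        mul_le_mul_of_nonneg_left hnorm (by positivity)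
    _ = (fluxConst α * T * bigLam ε₀ * Real.sqrt m * |M|) * (((bigLam ε₀) ^ 3)⁻¹) ^ k := by
        rw [hq3, pow_succ]
        field_simp
    _ ≤ c * (((bigLam ε₀) ^ 3)⁻¹) ^ k := by
        refine mul_le_mul_of_nonneg_right ?_ (pow_nonneg hy0 k)
        rw [hc_def]; linarith
    _ ≤ 1 := hck

/-! ### Along a robust blow-up -/

/-- **EVERY SHELL FIRES ALONG A ROBUST BLOW-UP, LATE ON HIGH SHELLS.** If `NoGlobalCascade ε₀ α X₀` (`ε₀ > 0`,
`α ∈ E₂(R)`, any `m`), then along the maximal exact cascade flow `X` from the one-shell datum on `[0,T⋆)`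
(`criticalBlowup_of_noGlobalCascade`: `C¹`, datum, no shells below `0`, exact motion, (4.5)-regular before `T⋆`)
EVERY shell `k ∈ ℕ` reaches the critical floor `1 < C_A T⋆ Λ^{k+1}‖x_k(t)‖` at some `t ∈ [0,T⋆)`, and for every
`T' < T⋆` the shells `k ≥ K(T')` reach it only at times `t > T'`.
[cite: Tao2016AveragedNS, §4 Thm. 4.2 (statement shape), (4.3), Lemma 4.1 (4.5), (4.8)–(4.10), (4.12); §1.2] -/
theorem everyShellFires_of_noGlobalCascade {ε₀ R : ℝ} (hε : 0 < ε₀)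
    {α : Fin m → Fin m → Fin m → ℤ × ℤ × ℤ → ℝ} {X₀ : Fin m → ℝ} (hα : InTableClass R α)
    (hNG : NoGlobalCascade ε₀ α X₀) :
    ∃ (T : ℝ) (X : Fin m → ℤ → ℝ → ℝ), 0 < T ∧
      (∀ i n, ContDiffOn ℝ 1 (X i n) (Set.Ico 0 T)) ∧
      (∀ i n, X i n 0 = if n = 0 then X₀ i else 0) ∧
      (∀ i n t, n < 0 → X i n t = 0) ∧
      (∀ i n t, 0 ≤ t → t < T → derivWithin (X i n) (Set.Ici 0) t = quadTerm ε₀ α X i n t) ∧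
      (∀ T' : ℝ, 0 < T' → T' < T → ∃ M : ℝ, ∀ t : ℝ, 0 ≤ t → t ≤ T' →
        ∀ (i : Fin m) (n : ℤ), (1 + (1 + ε₀) ^ ((10 : ℝ) * n)) * |X i n t| ≤ M) ∧
      (∀ k : ℕ, ∃ t : ℝ, 0 ≤ t ∧ t < T ∧
        1 < fluxConst α * T * bigLam ε₀ ^ (k + 1) * ‖shellVec X (k : ℤ) t‖) ∧
      (∀ T' : ℝ, T' < T → ∃ K : ℕ, ∀ k : ℕ, K ≤ k → ∃ t : ℝ, T' < t ∧ t < T ∧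
        1 < fluxConst α * T * bigLam ε₀ ^ (k + 1) * ‖shellVec X (k : ℤ) t‖) := by
  obtain ⟨T, X, hT, h1, h2, h3, h4, h5, h6⟩ := criticalBlowup_of_noGlobalCascade hε hα hNG
  have hder : ∀ i k, ∀ τ ∈ Ico (0 : ℝ) T,
      HasDerivWithinAt (X i k) (quadTerm ε₀ α X i k τ) (Ici 0) τ := by
    intro i k τ hτ
    have hd : DifferentiableWithinAt ℝ (X i k) (Ico 0 T) τ :=
      ((h1 i k).differentiableOn one_ne_zero) τ hτ
    have hd' : DifferentiableWithinAt ℝ (X i k) (Ici 0) τ :=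
      hd.mono_of_mem_nhdsWithin (by
        rw [mem_nhdsWithin]
        exact ⟨Iio T, isOpen_Iio, hτ.2, fun x hx => ⟨hx.2, hx.1⟩⟩)
    rw [← h4 i k τ hτ.1 hτ.2]
    exact hd'.hasDerivWithinAt
  have hreg : ∀ T' : ℝ, T' < T → ∃ M : ℝ, ∀ τ ∈ Icc (0 : ℝ) T', ∀ (i : Fin m) (k : ℤ),
      (1 + (1 + ε₀) ^ ((10 : ℝ) * k)) * |X i k τ| ≤ M := by
    intro T' hT'
    rcases le_or_gt T' 0 with h0 | h0
    · obtain ⟨M, hM⟩ := h5 (T / 2) (by linarith) (by linarith)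
      exact ⟨M, fun τ hτ i k => hM τ hτ.1 (by linarith [hτ.2]) i k⟩
    · obtain ⟨M, hM⟩ := h5 T' h0 hT'
      exact ⟨M, fun τ hτ i k => hM τ hτ.1 hτ.2 i k⟩
  have hfire := everyShellFires hε hT hα.2.1 hder h2 h3 hreg h6
  refine ⟨T, X, hT, h1, h2, h3, h4, h5, hfire, fun T' hT' => ?_⟩
  obtain ⟨K, hK⟩ := firing_late (α := α) hε hT hreg hT'
  refine ⟨K, fun k hk => ?_⟩
  obtain ⟨t, ht0, htT, hlt⟩ := hfire k
  refine ⟨t, ?_, htT, hlt⟩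
  by_contra hle
  exact absurd (hK k hk t ⟨ht0, not_lt.1 hle⟩) (not_le.2 hlt)

/-- `physWeight 5 ε₀ = 1`: at the critical exponent `a = 5` the physical weight is trivial.
[cite: Tao2016AveragedNS, §4 (4.1); cell vocabulary (`physWeight`)] -/
theorem physWeight_five {ε₀ : ℝ} (hε : 0 < ε₀) : physWeight 5 ε₀ = 1 := by
  have hb : (0 : ℝ) < 1 + ε₀ := by linarith
  unfold physWeight
  rw [show (5 : ℝ) = ((5 : ℕ) : ℝ) by norm_num, Real.rpow_natCast]
  exact div_self (pow_ne_zero _ hb.ne')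

/-- **THE RENORMALISED ROBUST BLOW-UP IS (S₅)-SURVIVING FORWARD.** If `NoGlobalCascade ε₀ α X₀` (`ε₀ > 0`,
`α ∈ E₂(R)`, any `m`), then the maximal exact flow `X` on `[0,T⋆)` and ANY renormalisation `W` of it around `T⋆`
(`W_n(σ) = Λ^n e^{-σ} x_n(T⋆ - e^{-σ})`; such a `W` exists, e.g. this very formula) satisfy
`EternalSurvivingFwd 5 ε₀ W`: the `a = 5`-weighted renormalised energy `e^{2σ}‖W_n(σ)‖² = (Λ^n‖x_n(t)‖)²` exceeds
`(C_A T⋆ Λ)⁻²` at arbitrarily high shells and arbitrarily late log-times (the firing times of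
`everyShellFires_of_noGlobalCascade`). The stub needs `a = 1`; the gap is the open front-survival content.
[cite: Tao2016AveragedNS, §4 Thm. 4.2 (statement shape), (4.8)–(4.10), (4.12), §6.4; cell vocabulary (`EternalSurvivingFwd`)] -/
theorem eternalSurvivingFwd_five_of_noGlobalCascade {ε₀ R : ℝ} (hε : 0 < ε₀)
    {α : Fin m → Fin m → Fin m → ℤ × ℤ × ℤ → ℝ} {X₀ : Fin m → ℝ} (hα : InTableClass R α)
    (hNG : NoGlobalCascade ε₀ α X₀) :
    ∃ (T : ℝ) (X : Fin m → ℤ → ℝ → ℝ), 0 < T ∧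
      (∀ i n, ContDiffOn ℝ 1 (X i n) (Set.Ico 0 T)) ∧
      (∀ i n, X i n 0 = if n = 0 then X₀ i else 0) ∧
      (∀ i n t, n < 0 → X i n t = 0) ∧
      (∀ i n t, 0 ≤ t → t < T → derivWithin (X i n) (Set.Ici 0) t = quadTerm ε₀ α X i n t) ∧
      (∀ T' : ℝ, 0 < T' → T' < T → ∃ M : ℝ, ∀ t : ℝ, 0 ≤ t → t ≤ T' →
        ∀ (i : Fin m) (n : ℤ), (1 + (1 + ε₀) ^ ((10 : ℝ) * n)) * |X i n t| ≤ M) ∧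
      0 < fluxConst α ∧
      (∀ W : ℤ → ℝ → Em m,
        (∀ n σ, W n σ = (bigLam ε₀ ^ n * Real.exp (-σ)) • shellVec X n (T - Real.exp (-σ))) →
          EternalSurvivingFwd 5 ε₀ W) := by
  obtain ⟨T, X, hT, h1, h2, h3, h4, h5, hfire, hlate⟩ := everyShellFires_of_noGlobalCascade hε hα hNG
  have hL : 0 < bigLam ε₀ := bigLam_pos (by linarith)
  have hCA : 0 ≤ fluxConst α := fluxConst_nonneg α
  -- `C_A > 0`: shell `0` fires, so `C_A T Λ ‖x_0‖ > 1 > 0`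
  have hCApos : 0 < fluxConst α := by
    obtain ⟨t, -, -, hlt⟩ := hfire 0
    by_contra h0
    have h0' : fluxConst α = 0 := le_antisymm (not_lt.1 h0) hCA
    rw [h0', zero_mul, zero_mul, zero_mul] at hlt
    exact absurd hlt (by norm_num)
  refine ⟨T, X, hT, h1, h2, h3, h4, h5, hCApos, fun W hW => ?_⟩
  set c : ℝ := ((fluxConst α * T * bigLam ε₀) ^ 2)⁻¹ with hc_def
  have hc0 : 0 < c := by positivity
  refine ⟨c, hc0, fun N => ?_⟩
  -- late firing beyond `T' = T - e^{-N}`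
  obtain ⟨K, hK⟩ := hlate (T - Real.exp (-(N : ℝ))) (by linarith [Real.exp_pos (-(N : ℝ))])
  obtain ⟨t, hT't, htT, hlt⟩ := hK (max K N) (le_max_left _ _)
  have hpos : 0 < T - t := by linarith
  refine ⟨max K N, le_max_right _ _, -Real.log (T - t), ?_, ?_⟩
  · have h1' : Real.log (T - t) ≤ -(N : ℝ) := by
      rw [← Real.log_exp (-(N : ℝ))]
      exact Real.log_le_log hpos (by linarith)
    linarith
  · rw [physWeight_five hε, one_pow, one_mul, renormalisedFlow_norm hε hW, neg_neg, Real.exp_log hpos,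
      sub_sub_cancel, zpow_natCast]
    -- `e^{2σ} (Λ^n (T-t) ‖x_n(t)‖)² = (Λ^n ‖x_n(t)‖)²` with `e^{σ} = (T-t)⁻¹`
    have hexp : Real.exp (2 * -Real.log (T - t)) = ((T - t) ^ 2)⁻¹ := by
      rw [show 2 * -Real.log (T - t) = -(Real.log (T - t) + Real.log (T - t)) by ring, Real.exp_neg,
        Real.exp_add, Real.exp_log hpos, sq]
    rw [hexp]
    have hkey : 1 < fluxConst α * T * bigLam ε₀ * (bigLam ε₀ ^ (max K N) * ‖shellVec X ((max K N : ℕ) : ℤ) t‖) := by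
      calc (1 : ℝ) < fluxConst α * T * bigLam ε₀ ^ (max K N + 1) * ‖shellVec X ((max K N : ℕ) : ℤ) t‖ := hlt
        _ = fluxConst α * T * bigLam ε₀ * (bigLam ε₀ ^ (max K N) * ‖shellVec X ((max K N : ℕ) : ℤ) t‖) := by
            ring
    have hq : 0 < fluxConst α * T * bigLam ε₀ := by positivity
    have hy : (fluxConst α * T * bigLam ε₀)⁻¹ < bigLam ε₀ ^ (max K N) * ‖shellVec X ((max K N : ℕ) : ℤ) t‖ := by
      rw [inv_eq_one_div, div_lt_iff₀ hq]
      linarith [hkey]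
    have hy0 : 0 ≤ (fluxConst α * T * bigLam ε₀)⁻¹ := by positivity
    calc c = ((fluxConst α * T * bigLam ε₀)⁻¹) ^ 2 := by rw [hc_def, inv_pow]
      _ ≤ (bigLam ε₀ ^ (max K N) * ‖shellVec X ((max K N : ℕ) : ℤ) t‖) ^ 2 := pow_le_pow_left₀ hy0 hy.le 2
      _ = ((T - t) ^ 2)⁻¹ * (bigLam ε₀ ^ (max K N) * (T - t) * ‖shellVec X ((max K N : ℕ) : ℤ) t‖) ^ 2 := by
          field_simp

end BlowupRigidityOne

end Summit.NavierStokesRegularity.NavierStokesRegularity.Theorems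

end
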